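import Mathlib.NumberTheory.ArithmeticFunction.Moebius
import Mathlib.NumberTheory.LSeries.Dirichlet
import Mathlib.NumberTheory.LSeries.HurwitzZetaValues
import Mathlib.Analysis.PSeries
import HarnessLib

/-!
# The density of square-free integers in a progression as an Euler product

Companion to `SquarefreeProgressions`: the density `g(q, r) = ∑_{d ≥ 1} μ(d) [gcd(d², q) ∣ r] / lcm(d², q)`
of the square-free integers `n ≡ r (mod q)` (`abs_card_squarefree_progression_sub_le`) equals
`(6/(π² q)) ∏_{p ∣ q} (1 − h(p)/p²) (1 − p⁻²)⁻¹`, `h(p) = [gcd(p², q) ∣ r] gcd(p², q)`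
(`tsum_moebius_density_eq_prod`), i.e. the local factor at `p ∥ q` is `1 − [p ∣ r]/p` and at `p² ∣ q`
it is `1 − [p² ∣ r]` (`sq_gcd_eq_pow_min`). This is the shape of the constant in Prachar's theorem
(Monatsh. Math. 62 (1958)) and in Taniguchi–Thorne, Duke Math. J. 162 (2013), Lemma 21
[cite: TaniguchiThorne2013, Lemma 21]; the proof here is the folklore one.

Method (no infinite products): for a bounded weight `w` with `w(mn) = w(m) w(n)` for coprime `m, n`,
removing one prime `p` from the support of `∑_d μ(d) w(d)/d²` multiplies it by `(1 − w(p)/p²)`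
(`tsum_sifted_moebius_weight_insert`: split `d` by `p ∣ d`, reindex `d = p d'`, use `μ(p d') = −μ(d')`
or `0`); by induction `∑_d μ(d) w(d)/d² = ∏_{p ∈ s} (1 − w(p)/p²) · ∑_{(d, s) = 1} μ(d) w(d)/d²`
(`tsum_moebius_weight_eq_prod_mul_sifted`). With `s` the primes of `q`, the sifted series no longer
sees `w` (there `w = 1`), so comparing `w = h` with `w = 1` and `∑ μ(d)/d² = 6/π²` (Mathlib:
`L(ζ, 2) L(μ, 2) = 1`, `ζ(2) = π²/6`) gives the product.

## Mathlib / tree search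

`ArithmeticFunction.LSeries_zeta_mul_Lseries_moebius`, `ArithmeticFunction.LSeries_zeta_eq_riemannZeta`,
`riemannZeta_two`, `Complex.ofReal_tsum` (the same route as the tree's
`Literature.NumberTheory.Sieve.CubicSieve.tsum_moebiusSq`, re-derived privately here to keep this file's
imports to Mathlib), `Function.Injective.tsum_eq`,
`ArithmeticFunction.isMultiplicative_moebius`, `Nat.Coprime.gcd_mul`, `Nat.factorization_gcd`.
-/

noncomputable section

open Finset ArithmeticFunction
open scoped ArithmeticFunction.Moebius

namespace Literature.NumberTheory.Sieve

/-! ### `∑ μ(d)/d² = 6/π²` -/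

/-- `∑_{d ≥ 1} μ(d)/d² = 6/π² = 1/ζ(2)` (Mathlib: `L(ζ,2) L(μ,2) = 1`, `ζ(2) = π²/6`); a private copy of
`Literature.NumberTheory.Sieve.CubicSieve.tsum_moebiusSq`. [folklore] -/
private theorem tsum_moebius_div_sq : ∑' d : ℕ, (μ d : ℝ) / (d : ℝ) ^ 2 = 6 / Real.pi ^ 2 := by
  have hs : 1 < (2 : ℂ).re := by norm_num
  have hzeta : LSeries (fun n => (ArithmeticFunction.zeta n : ℂ)) 2 = (Real.pi : ℂ) ^ 2 / 6 := by
    rw [ArithmeticFunction.LSeries_zeta_eq_riemannZeta hs, riemannZeta_two]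
  have hmu : LSeries (fun n => (μ n : ℂ)) 2 = 6 / (Real.pi : ℂ) ^ 2 := by
    have h := ArithmeticFunction.LSeries_zeta_mul_Lseries_moebius hs
    rw [hzeta] at h
    have hpi : (Real.pi : ℂ) ^ 2 ≠ 0 := pow_ne_zero 2 (by exact_mod_cast Real.pi_ne_zero)
    field_simp at h
    field_simp
    linear_combination h
  have hterm : ∀ n : ℕ, (((μ n : ℝ) / (n : ℝ) ^ 2 : ℝ) : ℂ) = LSeries.term (fun n => (μ n : ℂ)) 2 n := by
    intro n
    rcases eq_or_ne n 0 with rfl | hn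
    · simp [LSeries.term_zero]
    · rw [LSeries.term_of_ne_zero hn, Complex.cpow_two]
      push_cast
      rfl
  have h : ((∑' d : ℕ, (μ d : ℝ) / (d : ℝ) ^ 2 : ℝ) : ℂ) = 6 / (Real.pi : ℂ) ^ 2 := by
    rw [Complex.ofReal_tsum, ← hmu, LSeries]
    exact tsum_congr hterm
  exact_mod_cast h

/-! ### Sifted Möbius series with a bounded multiplicative weight -/

/-- `∑_d [P d] μ(d) w(d)/d²` converges absolutely for `w` bounded. [folklore] -/
theorem summable_sifted_moebius_weight {w : ℕ → ℝ} {B : ℝ} (hw : ∀ d, |w d| ≤ B)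
    (P : ℕ → Prop) [DecidablePred P] :
    Summable fun d : ℕ => if P d then (μ d : ℝ) * w d / (d : ℝ) ^ 2 else 0 := by
  have hB : 0 ≤ B := (abs_nonneg _).trans (hw 0)
  refine Summable.of_norm_bounded (g := fun d : ℕ => B * (1 / (d : ℝ) ^ 2))
    ((Real.summable_one_div_nat_pow.mpr one_lt_two).mul_left B) fun d => ?_
  rw [Real.norm_eq_abs]
  split_ifs
  · rcases Nat.eq_zero_or_pos d with rfl | hd
    · simp
    have hμ : |(μ d : ℝ)| ≤ 1 := by
      rcases ArithmeticFunction.moebius_eq_or d with h | h | h <;> simp [h]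
    rw [abs_div, abs_mul, abs_of_nonneg (by positivity : (0 : ℝ) ≤ (d : ℝ) ^ 2), mul_one_div]
    refine div_le_div_of_nonneg_right ?_ (by positivity)
    calc |(μ d : ℝ)| * |w d| ≤ 1 * B := mul_le_mul hμ (hw d) (abs_nonneg _) zero_le_one
      _ = B := one_mul B
  · rw [abs_zero]
    positivity

/-- **Removing one prime.** For `w` bounded with `w(mn) = w(m) w(n)` (`m, n` coprime), a finite set
`s` of primes and a prime `p ∉ s`:
`∑_{(d, s) = 1} μ(d) w(d)/d² = (1 − w(p)/p²) ∑_{(d, s ∪ {p}) = 1} μ(d) w(d)/d²`. [folklore] -/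
theorem tsum_sifted_moebius_weight_insert {w : ℕ → ℝ} {B : ℝ} (hw : ∀ d, |w d| ≤ B)
    (hmul : ∀ m n, Nat.Coprime m n → w (m * n) = w m * w n)
    {s : Finset ℕ} {p : ℕ} (hp : p.Prime) (hps : p ∉ s) (hs : ∀ p' ∈ s, p'.Prime) :
    ∑' d : ℕ, (if ∀ p' ∈ s, ¬ p' ∣ d then (μ d : ℝ) * w d / (d : ℝ) ^ 2 else 0)
      = (1 - w p / (p : ℝ) ^ 2) *
        ∑' d : ℕ, (if ∀ p' ∈ insert p s, ¬ p' ∣ d then (μ d : ℝ) * w d / (d : ℝ) ^ 2 else 0) := by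
  set F : ℕ → ℝ := fun d => if ∀ p' ∈ s, ¬ p' ∣ d then (μ d : ℝ) * w d / (d : ℝ) ^ 2 else 0
    with hF
  set G : ℕ → ℝ := fun d =>
    if ∀ p' ∈ insert p s, ¬ p' ∣ d then (μ d : ℝ) * w d / (d : ℝ) ^ 2 else 0 with hG
  have hGF : ∀ d, G d = if p ∣ d then 0 else F d := by
    intro d
    simp only [hG, hF, Finset.forall_mem_insert]
    by_cases hpd : p ∣ d <;> simp [hpd]
  -- `F (p d') = -(w p / p²) G d'`
  have heval : ∀ d', F (p * d') = -(w p / (p : ℝ) ^ 2) * G d' := by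
    intro d'
    rw [hGF]
    by_cases hpd : p ∣ d'
    · have hμ : μ (p * d') = 0 := by
        apply moebius_eq_zero_of_not_squarefree
        intro hsq
        obtain ⟨k, rfl⟩ := hpd
        exact hp.ne_one (Nat.isUnit_iff.mp (hsq p ⟨k, by ring⟩))
      simp [hF, hμ, hpd]
    · have hcop : Nat.Coprime p d' := (Nat.Prime.coprime_iff_not_dvd hp).mpr hpd
      rw [if_neg hpd]
      simp only [hF]
      by_cases hcond : ∀ p' ∈ s, ¬ p' ∣ d'
      · have hcond' : ∀ p' ∈ s, ¬ p' ∣ p * d' := by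
          intro p' hp' h
          rcases (Nat.Prime.dvd_mul (hs p' hp')).mp h with h1 | h1
          · exact hps (((Nat.prime_dvd_prime_iff_eq (hs p' hp') hp).mp h1) ▸ hp')
          · exact hcond p' hp' h1
        rw [if_pos hcond', if_pos hcond, isMultiplicative_moebius.map_mul_of_coprime hcop,
          moebius_apply_prime hp, hmul _ _ hcop]
        have hp0 : (p : ℝ) ≠ 0 := by exact_mod_cast hp.ne_zero
        push_cast
        field_simp
      · have hcond' : ¬ ∀ p' ∈ s, ¬ p' ∣ p * d' :=
          fun h => hcond fun p' hp' hd => h p' hp' (dvd_mul_of_dvd_right hd p)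
        rw [if_neg hcond', if_neg hcond]
        ring
  have hsumF : Summable F := summable_sifted_moebius_weight hw _
  have hsumG : Summable G := summable_sifted_moebius_weight hw _
  -- split `F = G + [p ∣ d] F` and reindex the second piece by `d = p d'`
  have hsplit : ∀ d, F d = G d + (if p ∣ d then F d else 0) := by
    intro d
    rw [hGF]
    by_cases hpd : p ∣ d <;> simp [hpd]
  have hsum2 : Summable (fun d => if p ∣ d then F d else 0) := by
    refine (hsumF.sub hsumG).congr fun d => ?_
    linarith [hsplit d]
  have hreindex : ∑' d, (if p ∣ d then F d else 0) = ∑' d', F (p * d') := by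
    have hinj : Function.Injective (fun d' : ℕ => p * d') := mul_right_injective₀ hp.ne_zero
    rw [← hinj.tsum_eq (f := fun d => if p ∣ d then F d else 0)]
    · exact tsum_congr fun d' => by simp
    · intro d hd
      rw [Function.mem_support] at hd
      have hpd : p ∣ d := by
        by_contra h
        exact hd (if_neg h)
      obtain ⟨k, rfl⟩ := hpd
      exact ⟨k, rfl⟩
  calc ∑' d, F d = ∑' d, (G d + (if p ∣ d then F d else 0)) := tsum_congr hsplit
    _ = ∑' d, G d + ∑' d, (if p ∣ d then F d else 0) := hsumG.tsum_add hsum2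
    _ = ∑' d, G d + ∑' d', -(w p / (p : ℝ) ^ 2) * G d' := by
        rw [hreindex]
        exact congrArg _ (tsum_congr heval)
    _ = (1 - w p / (p : ℝ) ^ 2) * ∑' d, G d := by
        rw [tsum_mul_left]
        ring

/-- **Finite Euler factorisation of a sifted Möbius series**: for `w` bounded and multiplicative on
coprime arguments and `s` a finite set of primes,
`∑_d μ(d) w(d)/d² = ∏_{p ∈ s} (1 − w(p)/p²) · ∑_{(d, s) = 1} μ(d) w(d)/d²`. [folklore] -/
theorem tsum_moebius_weight_eq_prod_mul_sifted {w : ℕ → ℝ} {B : ℝ} (hw : ∀ d, |w d| ≤ B)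
    (hmul : ∀ m n, Nat.Coprime m n → w (m * n) = w m * w n)
    (s : Finset ℕ) (hs : ∀ p ∈ s, p.Prime) :
    ∑' d : ℕ, (μ d : ℝ) * w d / (d : ℝ) ^ 2
      = (∏ p ∈ s, (1 - w p / (p : ℝ) ^ 2)) *
        ∑' d : ℕ, (if ∀ p ∈ s, ¬ p ∣ d then (μ d : ℝ) * w d / (d : ℝ) ^ 2 else 0) := by
  induction s using Finset.induction_on with
  | empty => simp
  | insert p s hps ih =>
    rw [Finset.forall_mem_insert] at hs
    rw [ih hs.2, tsum_sifted_moebius_weight_insert hw hmul hs.1 hps hs.2, Finset.prod_insert hps]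
    ring

/-! ### The weight `h(d) = [gcd(d², q) ∣ r] · gcd(d², q)` -/

/-- `h` is multiplicative on coprime arguments. [folklore] -/
theorem gcdWeight_mul_of_coprime (q : ℕ) (r : ℤ) {m n : ℕ} (hmn : Nat.Coprime m n) :
    (if ((((m * n) ^ 2).gcd q : ℕ) : ℤ) ∣ r then ((((m * n) ^ 2).gcd q : ℕ) : ℝ) else 0)
      = (if (((m ^ 2).gcd q : ℕ) : ℤ) ∣ r then (((m ^ 2).gcd q : ℕ) : ℝ) else 0) *
        (if (((n ^ 2).gcd q : ℕ) : ℤ) ∣ r then (((n ^ 2).gcd q : ℕ) : ℝ) else 0) := by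
  have hcop2 : Nat.Coprime (m ^ 2) (n ^ 2) := Nat.Coprime.pow 2 2 hmn
  have hg : ((m * n) ^ 2).gcd q = (m ^ 2).gcd q * ((n ^ 2).gcd q) := by
    rw [mul_pow, Nat.gcd_comm, Nat.Coprime.gcd_mul q hcop2, Nat.gcd_comm q, Nat.gcd_comm q]
  have hcopg : Nat.Coprime ((m ^ 2).gcd q) ((n ^ 2).gcd q) :=
    Nat.Coprime.coprime_dvd_left (Nat.gcd_dvd_left _ _)
      (Nat.Coprime.coprime_dvd_right (Nat.gcd_dvd_left _ _) hcop2)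
  have hdvd : ((((m * n) ^ 2).gcd q : ℕ) : ℤ) ∣ r ↔
      (((m ^ 2).gcd q : ℕ) : ℤ) ∣ r ∧ (((n ^ 2).gcd q : ℕ) : ℤ) ∣ r := by
    rw [hg]
    refine ⟨fun h => ⟨(Int.natCast_dvd_natCast.mpr (dvd_mul_right _ _)).trans h,
      (Int.natCast_dvd_natCast.mpr (dvd_mul_left _ _)).trans h⟩, fun h => ?_⟩
    rw [Int.natCast_dvd] at h ⊢
    rw [Int.natCast_dvd] at h
    exact hcopg.mul_dvd_of_dvd_of_dvd h.1 h.2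
  by_cases h1 : (((m ^ 2).gcd q : ℕ) : ℤ) ∣ r <;> by_cases h2 : (((n ^ 2).gcd q : ℕ) : ℤ) ∣ r
  · rw [if_pos (hdvd.mpr ⟨h1, h2⟩), if_pos h1, if_pos h2, hg]
    push_cast
    ring
  · rw [if_neg (fun h => h2 (hdvd.mp h).2), if_pos h1, if_neg h2]
    ring
  · rw [if_neg (fun h => h1 (hdvd.mp h).1), if_neg h1, if_pos h2]
    ring
  · rw [if_neg (fun h => h1 (hdvd.mp h).1), if_neg h1, if_neg h2]
    ring

/-- `|h(d)| ≤ q` for `q ≥ 1`. [folklore] -/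
theorem abs_gcdWeight_le {q : ℕ} (hq : 0 < q) (r : ℤ) (d : ℕ) :
    |(if (((d ^ 2).gcd q : ℕ) : ℤ) ∣ r then (((d ^ 2).gcd q : ℕ) : ℝ) else 0)| ≤ q := by
  split_ifs
  · rw [Nat.abs_cast]
    exact_mod_cast Nat.gcd_le_right _ hq
  · simp

/-- For `d` prime to every prime factor of `q ≠ 0`: `gcd(d², q) = 1`, so `h(d) = 1`. [folklore] -/
theorem sq_gcd_eq_one_of_forall_not_dvd {q d : ℕ} (hq : q ≠ 0)
    (hd : ∀ p ∈ q.primeFactors, ¬ p ∣ d) : (d ^ 2).gcd q = 1 := by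
  have hcop : Nat.Coprime d q := by
    refine Nat.coprime_of_dvd fun k hk hkd hkq => ?_
    exact hd k (Nat.mem_primeFactors.mpr ⟨hk, hkq, hq⟩) hkd
  exact Nat.Coprime.gcd_eq_one (Nat.Coprime.pow_left 2 hcop)

/-! ### The Euler product for the density -/

/-- **The density of square-free integers `≡ r (mod q)` as a finite Euler product** (`q ≥ 1`):
`∑_{d ≥ 1} μ(d) [gcd(d², q) ∣ r]/lcm(d², q) = (6/(π² q)) ∏_{p ∣ q} (1 − h(p)/p²)(1 − p⁻²)⁻¹`,
`h(p) = [gcd(p², q) ∣ r] gcd(p², q)`. [folklore] -/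
theorem tsum_moebius_density_eq_prod {q : ℕ} (hq : 0 < q) (r : ℤ) :
    ∑' d : ℕ, (μ d : ℝ) * (if (((d ^ 2).gcd q : ℕ) : ℤ) ∣ r then 1 / (((d ^ 2).lcm q : ℕ) : ℝ) else 0)
      = 6 / (Real.pi ^ 2 * q) * ∏ p ∈ q.primeFactors,
          (1 - (if (((p ^ 2).gcd q : ℕ) : ℤ) ∣ r then (((p ^ 2).gcd q : ℕ) : ℝ) else 0) / (p : ℝ) ^ 2)
            * (1 - 1 / (p : ℝ) ^ 2)⁻¹ := by
  set h : ℕ → ℝ := fun d => if (((d ^ 2).gcd q : ℕ) : ℤ) ∣ r then (((d ^ 2).gcd q : ℕ) : ℝ) else 0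
    with hh
  have hqR : (q : ℝ) ≠ 0 := by exact_mod_cast hq.ne'
  have hprimes : ∀ p ∈ q.primeFactors, p.Prime := fun p hp => Nat.prime_of_mem_primeFactors hp
  -- the density series is `(1/q) ∑ μ(d) h(d)/d²`
  have hterm : ∀ d : ℕ, (μ d : ℝ) * (if (((d ^ 2).gcd q : ℕ) : ℤ) ∣ r then
      1 / (((d ^ 2).lcm q : ℕ) : ℝ) else 0) = 1 / (q : ℝ) * ((μ d : ℝ) * h d / (d : ℝ) ^ 2) := by
    intro d
    simp only [hh]
    split_ifs
    · rcases Nat.eq_zero_or_pos d with rfl | hd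
      · simp
      have hgl : (((d ^ 2).gcd q : ℕ) : ℝ) * (((d ^ 2).lcm q : ℕ) : ℝ) = (d : ℝ) ^ 2 * q := by
        exact_mod_cast Nat.gcd_mul_lcm (d ^ 2) q
      have hl0 : (((d ^ 2).lcm q : ℕ) : ℝ) ≠ 0 := by
        exact_mod_cast (Nat.lcm_pos (pow_pos hd 2) hq).ne'
      have hd0 : (d : ℝ) ≠ 0 := by exact_mod_cast hd.ne'
      have hinv : (1 : ℝ) / (((d ^ 2).lcm q : ℕ) : ℝ) = (((d ^ 2).gcd q : ℕ) : ℝ) / ((d : ℝ) ^ 2 * q) := by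
        rw [eq_div_iff (by positivity), ← hgl]
        field_simp
      rw [hinv]
      ring
    · simp
  -- Euler factorisation for `w = h` and for `w = 1`
  have hEh := tsum_moebius_weight_eq_prod_mul_sifted (abs_gcdWeight_le hq r)
    (fun m n hmn => gcdWeight_mul_of_coprime q r hmn) q.primeFactors hprimes
  have hE1 := tsum_moebius_weight_eq_prod_mul_sifted (w := fun _ => (1 : ℝ)) (B := 1)
    (fun _ => by simp) (fun _ _ _ => by simp) q.primeFactors hprimes
  -- the two sifted series agree
  have hsift : ∑' d : ℕ, (if ∀ p ∈ q.primeFactors, ¬ p ∣ d then (μ d : ℝ) * h d / (d : ℝ) ^ 2 else 0)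
      = ∑' d : ℕ, (if ∀ p ∈ q.primeFactors, ¬ p ∣ d then (μ d : ℝ) * 1 / (d : ℝ) ^ 2 else 0) := by
    refine tsum_congr fun d => ?_
    split_ifs with hd
    · simp only [hh, sq_gcd_eq_one_of_forall_not_dvd hq.ne' hd]
      simp
    · rfl
  -- `∑ μ(d)/d² = 6/π²`, and the product `∏ (1 - p⁻²)` is nonzero
  have h6 : ∑' d : ℕ, (μ d : ℝ) * 1 / (d : ℝ) ^ 2 = 6 / Real.pi ^ 2 := by
    simpa using tsum_moebius_div_sq
  have hprod_ne : ∏ p ∈ q.primeFactors, (1 - (1 : ℝ) / (p : ℝ) ^ 2) ≠ 0 := by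
    refine Finset.prod_ne_zero_iff.mpr fun p hp => ?_
    have hp2 : (2 : ℝ) ≤ p := by exact_mod_cast (hprimes p hp).two_le
    have : (1 : ℝ) / (p : ℝ) ^ 2 < 1 := by
      rw [div_lt_one (by positivity)]
      nlinarith
    linarith
  -- assemble
  set T := ∑' d : ℕ, (if ∀ p ∈ q.primeFactors, ¬ p ∣ d then (μ d : ℝ) * 1 / (d : ℝ) ^ 2 else 0)
    with hT
  have hT' : T = 6 / Real.pi ^ 2 / ∏ p ∈ q.primeFactors, (1 - (1 : ℝ) / (p : ℝ) ^ 2) := by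
    rw [eq_div_iff hprod_ne, ← h6, hE1]
    simp [hT, mul_comm]
  rw [tsum_congr hterm, tsum_mul_left, hEh, hsift, hT', Finset.prod_mul_distrib,
    Finset.prod_inv_distrib]
  rw [div_div, div_eq_mul_inv, div_eq_mul_inv, div_eq_mul_inv]
  ring

/-- `gcd(p², q) = p^{min(2, v_p(q))}` for `p` prime, `q ≠ 0`. [folklore] -/
theorem sq_gcd_eq_pow_min {p q : ℕ} (hp : p.Prime) (hq : q ≠ 0) :
    (p ^ 2).gcd q = p ^ min 2 (q.factorization p) := by
  apply Nat.eq_pow_of_factorization_eq_single (Nat.gcd_ne_zero_right hq)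
  rw [Nat.factorization_gcd (pow_ne_zero 2 hp.ne_zero) hq, hp.factorization_pow]
  ext x
  rw [Finsupp.inf_apply, Finsupp.single_apply, Finsupp.single_apply]
  by_cases hx : p = x
  · subst hx
    simp
  · simp [hx]

end Literature.NumberTheory.Sieve

end
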